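import Summits.BirchSwinnertonDyer.Rank1Residual.GaloisImage.PropagatedConditionCardEP
import Literature.NumberTheory.EllipticCurves.LocalEulerCharacteristicTorsion
import HarnessLib

/-!
# [MR04] Lemma A.1 at level one for an elliptic curve: `E(ℚ_p)[p] = 0 ⇒ 𝓕_can(E[p])_p = H¹(ℚ_p, E[p])`
# (THEOREM B of row T-DER at the place `v ∣ p` — the D7 locus — level one)
# (cell `b2b-bsdres`, team n1011, seat p11 GEN 8, OWNERS row T-DER = skel/T-DER.md STATUS v6; file F11)

HONEST FRAMING (cell `b2b-bsdres`, run/shared/lean/b2b/bsd-rank1-residual/, verbatim in every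
file): the goal of the cell is to DELETE the COMBINATION-SHAPED residual classes of the
Birch–Swinnerton-Dyer formula for ALL analytic-rank `≤ 1` elliptic curves over `ℚ` — "full BSD
formula for every rank `≤ 1` curve in class `C`" assembled STRICTLY from published theorems — so
that the rank-`≤ 1` remainder becomes exactly the CONSTRUCTION-SHAPED classes, which are TYPED
(missing-input `Prop`s), NOT attempted. This is not "finishing BSD". Team n1011: research route on
the CONSTRUCTION-SHAPED class X4; no claim beyond the stated classes; nothing is booked. TOOL
theorems (no definition, no named fact, no `sorry`).

## What

Mazur–Rubin, *Kolyvagin systems*, App. A, Lemma A.1: "If `H⁰(ℚ_p, T*)` is a divisible `R`-module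
then for every ideal `I` of `R`, `H¹_𝓕(ℚ_p, T/IT) = H¹(ℚ_p, T/IT)`" (proof: the cokernel of
`H¹(ℚ_p, T) → H¹(ℚ_p, T/IT)` is `H²(ℚ_p, T)[I] ≅ Hom(H⁰(ℚ_p, T*)/I, ℚ_p/ℤ_p)`).  For `T = T_p E`,
`T* ≅ E[p^∞]` and the hypothesis reads `E(ℚ_p)[p] = 0` — the cell's D7 / `KS-vs-KSbar@3` locus.
This file proves the LEVEL-ONE case for an elliptic curve `E/ℚ` by COUNTING, from theorems of the
tree only: n1011-p04's `#𝓕_can(E[p])_{(p)} = p² · #E(ℚ_p)[p]` (`natCard_propagatedSelmerStructureOne_of_mem`,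
Tate's local Euler–Poincaré characteristic discharged, p300886) and
`#H¹(ℚ_p, E[p]) = (#E(ℚ_p)[p] · #(ℤ_p/p))²` (`natCard_galoisCohomology_one_torsion_adicCompletion_eq_sq`):
under `E(ℚ_p)[p] = 0` both equal `p²`, so the inclusion `𝓕_can(E[p])_{(p)} ≤ H¹(ℚ_p, E[p])` is an
equality (`propagatedSelmerStructureOne_eq_top_of_torsion_eq_zero`).  Consequence for THEOREM B of
row T-DER at `v = p`: for a curve with `E(ℚ_p)[p] = 0` the canonical local condition at `p` on
`E[p]` is VACUOUS — every class (in particular `loc_p κ_r`) satisfies it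
(`mem_propagatedSelmerStructureOne_of_torsion_eq_zero`).  The level-`k+1` statement
(`𝓕_can(E[p^{k+1}])_{(p)} = ⊤` under the same hypothesis) is NOT proved here (it needs the
cocycle-lifting tower / a level-`k+1` count; skel/T-DER.md STATUS v6).

References: B. Mazur, K. Rubin, Mem. AMS 799 (2004), App. A, Lemma A.1 (p. 79); R. Greenberg,
LNM 1716 (1999) §2; J. S. Milne, *Arithmetic Duality Theorems* (2006), Ch. I Thm. 2.8, 3.2, Lemma 3.3.
-/

noncomputable section

open scoped Classical NumberField ContRepresentation
open Field NumberField IsDedekindDomain Function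
open WeierstrassCurve Literature.NumberTheory.EllipticCurves Literature.NumberTheory.GaloisRepresentations
  Literature.NumberTheory.GaloisRepresentations.DiscreteGaloisModule

namespace Summit.BirchSwinnertonDyer.Rank1Residual.GaloisImage

variable (W : WeierstrassCurve ℚ) [W.IsElliptic] (p : ℕ) [hp : Fact p.Prime]
  (v : HeightOneSpectrum (𝓞 ℚ))

/-- `#H¹(ℚ_v, E[p]) = (#E(ℚ_v)[p] · #(𝓞_v/p))²` at every finite place of `ℚ`, unconditionally (the
tree's `natCard_galoisCohomology_one_torsion_adicCompletion_eq_sq` with Tate's local Euler–Poincaré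
characteristic discharged, `EP.localEulerPoincareCharacteristic_adicCompletion`), in the
`toLocal (Sum.inr v)` spelling of the Selmer-structure files.
[cite: MilneADT2006, Ch. I §2, Thm. 2.8 and §3 Lemma 3.3] -/
theorem natCard_galoisCohomology_toLocal_torsion_eq_sq :
    Nat.card (galoisCohomology ((W.torsionGaloisModule (p : ℤ)).toLocal (Sum.inr v : Place ℚ)) 1) =
      (Nat.card (nsmulAddMonoidHom p : (W.baseChange (v.adicCompletion ℚ)).toAffine.Point →+ _).ker *
        Nat.card (v.adicCompletionIntegers ℚ ⧸
          Ideal.span {((p : ℕ) : v.adicCompletionIntegers ℚ)})) ^ 2 := by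
  haveI : NeZero p := ⟨hp.out.ne_zero⟩
  exact natCard_galoisCohomology_one_torsion_adicCompletion_eq_sq W v p hp.out.isPrimePow
    (EP.localEulerPoincareCharacteristic_adicCompletion ℚ v)

/-- **[MR04] Lemma A.1, level one, for an elliptic curve: `E(ℚ_p)[p] = 0 ⇒ 𝓕_can(E[p])_{(p)} = ⊤`.**
At the place `v ∣ p` of `ℚ`, if `E(ℚ_v)` has no `p`-torsion then Mazur–Rubin's canonical condition
on `E[p]` propagated from `T_p E` is ALL of `H¹(ℚ_p, E[p])`: both have `p²` elements
(`natCard_propagatedSelmerStructureOne_of_mem`: `p² · #E(ℚ_p)[p]`;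
`natCard_galoisCohomology_toLocal_torsion_eq_sq`: `(#E(ℚ_p)[p] · p)²`).
[cite: MazurRubin2004, App. A, Lemma A.1 (p. 79)] -/
theorem propagatedSelmerStructureOne_eq_top_of_torsion_eq_zero (hv : ((p : ℕ) : 𝓞 ℚ) ∈ v.asIdeal)
    (htors : ∀ P : (W.baseChange (v.adicCompletion ℚ)).toAffine.Point, p • P = 0 → P = 0) :
    propagatedSelmerStructureOne W p (Sum.inr v) = ⊤ := by
  -- `#E(ℚ_v)[p] = 1`
  have hker : Nat.card (nsmulAddMonoidHom p :
      (W.baseChange (v.adicCompletion ℚ)).toAffine.Point →+ _).ker = 1 := by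
    rw [Nat.card_eq_one_iff_exists]
    refine ⟨⟨0, by simp⟩, fun P => Subtype.ext ?_⟩
    exact htors P.1 (by simpa only [AddMonoidHom.mem_ker, nsmulAddMonoidHom_apply] using P.2)
  have hq : Nat.card (v.adicCompletionIntegers ℚ ⧸
      Ideal.span {((p : ℕ) : v.adicCompletionIntegers ℚ)}) = p :=
    natCard_quot_adicCompletionIntegers_of_prime_mem p hv
  -- the two counts
  have hF : Nat.card (propagatedSelmerStructureOne W p (Sum.inr v)) = p ^ 2 := by
    rw [natCard_propagatedSelmerStructureOne_of_mem W p v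
      (EP.localEulerPoincareCharacteristic_adicCompletion ℚ v) hv, hker, mul_one]
  have hH : Nat.card (galoisCohomology ((W.torsionGaloisModule (p : ℤ)).toLocal (Sum.inr v : Place ℚ)) 1) =
      p ^ 2 := by
    rw [natCard_galoisCohomology_toLocal_torsion_eq_sq W p v, hker, hq, one_mul]
  -- equal finite cardinalities and `𝓕 ≤ ⊤`
  haveI : Finite (galoisCohomology ((W.torsionGaloisModule (p : ℤ)).toLocal (Sum.inr v : Place ℚ)) 1) :=
    Nat.finite_of_card_ne_zero (by rw [hH]; exact pow_ne_zero _ hp.out.ne_zero)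
  refine AddSubgroup.eq_top_of_card_eq _ ?_
  rw [hF, hH]

/-- **THEOREM B of row T-DER at `v = p`, level one, under the D7 certificate**: if `E(ℚ_p)[p] = 0`
then EVERY class of `H¹(ℚ_p, E[p])` — in particular the localisation at `p` of Kolyvagin's
derivative class — lies in `𝓕_can(E[p])_{(p)}`. [cite: MazurRubin2004, App. A, Lemma A.1 (p. 79)] -/
theorem mem_propagatedSelmerStructureOne_of_torsion_eq_zero (hv : ((p : ℕ) : 𝓞 ℚ) ∈ v.asIdeal)
    (htors : ∀ P : (W.baseChange (v.adicCompletion ℚ)).toAffine.Point, p • P = 0 → P = 0)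
    (x : galoisCohomology ((W.torsionGaloisModule (p : ℤ)).toLocal (Sum.inr v : Place ℚ)) 1) :
    x ∈ propagatedSelmerStructureOne W p (Sum.inr v) := by
  rw [propagatedSelmerStructureOne_eq_top_of_torsion_eq_zero W p v hv htors]
  exact AddSubgroup.mem_top x

end Summit.BirchSwinnertonDyer.Rank1Residual.GaloisImage

end
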